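import Mathlib
import Literature.NumberTheory.LFunctions.Zhang2022.Section6Statements
import Literature.NumberTheory.LFunctions.Zhang2022.TypedSection01and02B
import HarnessLib

/-!
# Zhang (2022), §6, proof of Lemma 6.1: the three analytic bounds behind (6.2), kernel-checked
# (DAG `Z22:§6.u013`, `Z22:§6.u014`, and the prose node p. 32 tex L1746)

Topic `Literature/NumberTheory/LFunctions/Zhang2022` (Landau–Siegel audit tree; verdict-neutral).
Y. Zhang, *Discrete mean estimates and the Landau–Siegel zero*, arXiv:2211.02515v1 (2022)
[Zhang2022LandauSiegel] — **an unrefereed manuscript under adjudication; nothing here asserts or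
denies its Theorems 1–2.** Campaign D-0069 (discharge lane, layer L2): this THEOREM-ONLY file
discharges proof-internal claims of §6 typed (statement-exact) in `Section6Statements`
(namespace `…Zhang2022.Section6Statements`), against the banked skeleton objects.

§6 p. 32 (tex L1746–1754), inside the proof of (6.2):

> By a trivial bound for `ω₁(w)` and simple estimates, the integrals on the segments `u = −1`,
> `|v| > 𝓛²⁰` contribute `≪ ε`. On the other hand, in the case `−𝓛⁹ ≤ u ≤ −1`, `|v| ≤ 𝓛²⁰`, by (4.)
> we have `Z(s+w,ψ)P₄^w ≪ (2T²)^{−u}` and `Σ_{n ≥ T³} ψ̄(n)n^{−(1−s−w)} ≪ T^{3u+1/2}`, whence (6.2)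
> follows.

Scope (namespace `…Zhang2022.Section6TailBounds`): of the three bounds quoted above, THIS file
carries the tail `Σ_{n≥T³}` (`Z22:§6.u014`, `Section6Statements.Step6u014`) and the shared
parameter bookkeeping; `Z(s+w,ψ)P₄^w ≪ (2T²)^{−u}` (`Z22:§6.u013`, `Section6Statements.Step6u013`)
and the outer segments `u = −1, |v| > 𝓛²⁰` (`Section6Statements.Step6outer`) follow in the companion
`Section6ZfacBound.lean`. Every typed claim carries the blanket Assumption (A) binder of the typed
file (§5 p. 28); the bounds here do not use it.

| decl | DAG node | status |
|---|---|---|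
| `tsum_rpow_neg_tail_le`, `tsum_rpow_neg_tail_le'` (private) | — | the trivial tail estimate `Σ_{n ≥ N} n^{−a} ≤ N^{−a} + N^{1−a}/(a−1)` (integral test) |
| `norm_tailSum_le` | `§6.u014` | `‖Σ_{n≥T³} ψ̄(n)n^{−(1−s−w)}‖ ≤ 5·(T³)^{σ+u}` for `Re(1−s−w) = 1−σ−u ≥ 5/4` |
| `stepTail_repaired` | `§6.u014` (REPAIRED exponent) | PROVED: the binders of `Step6u014` verbatim with the bound `C·T^{3u+3/2}` (`−𝓛⁹ ≤ u ≤ −1`, `|v| ≤ 𝓛²⁰`, `s` in the range of Lemma 6.1), `D ≥ 9` |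
| `two_le_ell`, `alpha_le`, `alpha_mul_ell_rpow_le`, `bigT_pow_three` | — | parameter bookkeeping for `D ≥ 9` (`𝓛 ≥ 2`, `α ≤ 1/8`, `α𝓛^{1.1} ≤ π`, `T³ = e^{3𝓛^{1.1}}`; `α = π/𝓛⁹` is the tree's `Section2.alpha_eq_pi_div_ell9`) |

On the printed exponent `3u + 1/2` (`Section6Statements.Step6u014`, typed verbatim): with `Re(1−s−w) = 1−σ−u`
and `|σ − 1/2| < 2α` the trivial estimate gives `(T³)^{1−(1−σ−u)} = T^{3u+3σ} = T^{3u+3/2+O(α)}`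
— exponent `3u + 3/2`, not `3u + 1/2` (`3·½ = 3/2`); the manuscript offers no cancellation argument
and the complete character sums `|Σ_{n≤y} ψ̄(n)| ≤ p` are useless at `p ≍ P = e^{𝓛⁹} ≫ T = e^{𝓛^{1.1}}`.
The repaired form is what (6.2) actually needs (room `2T^{1/2}e^{−𝓛¹⁰/4}` on the horizontal
segments and `2^{𝓛⁹}T^{−𝓛⁹+3/2}` on `u = −𝓛⁹`, both `≪ exp{−c𝓛¹⁰}`); see plan/GAP-LEDGER.md row
`G-d23-1`. Nothing here is a new fact: only Mathlib (integral test, `∫_N^∞ x^{−a}dx`) and the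
skeleton's definitions are used.

## References

* Y. Zhang, arXiv:2211.02515v1 (2022), §6 p. 32, proof of Lemma 6.1, (6.2); §2 (2.10) `α`,
  §6 p. 30 `T = exp{𝓛^{1.1}}`. [cite: Zhang2022LandauSiegel, §6 (6.2) p.32]
-/

noncomputable section

open Complex Real MeasureTheory Set Filter

namespace Literature.NumberTheory.LFunctions.Zhang2022.Section6TailBounds

open Skeleton Section6Statements

/-! ## The trivial tail estimate `Σ_{n ≥ N} n^{−a}` (integral test) -/

/-- For `a > 1` and `N ≥ 1`: `Σ_{k ≥ 0} (k+N+1)^{−a} ≤ N^{1−a}/(a−1)` (the integral test against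
`∫_N^∞ x^{−a}dx = N^{1−a}/(a−1)`). [folklore] -/
private theorem tsum_rpow_neg_tail_le {a : ℝ} (ha : 1 < a) {N : ℕ} (hN : 1 ≤ N) :
    ∑' k : ℕ, ((k + N + 1 : ℕ) : ℝ) ^ (-a) ≤ (N : ℝ) ^ (1 - a) / (a - 1) := by
  have hN0 : (0 : ℝ) < N := by exact_mod_cast hN
  have anti : AntitoneOn (fun x : ℝ => x ^ (-a)) (Ici (N : ℝ)) :=
    (Real.antitoneOn_rpow_Ioi_of_exponent_nonpos (by linarith)).mono
      fun x hx => lt_of_lt_of_le hN0 hx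
  have integrable : IntegrableOn (fun x : ℝ => x ^ (-a)) (Ioi (N : ℝ)) :=
    integrableOn_Ioi_rpow_of_lt (by linarith) hN0
  have nonneg : ∀ t ∈ Ioi (N : ℝ), 0 ≤ t ^ (-a) := fun t ht =>
    Real.rpow_nonneg (hN0.trans ht).le _
  have h := anti.tsum_comp_add_le_integral N integrable nonneg
  rw [integral_Ioi_rpow_of_lt (by linarith) hN0] at h
  have e : -(N : ℝ) ^ (-a + 1) / (-a + 1) = (N : ℝ) ^ (1 - a) / (a - 1) := by
    rw [show -a + 1 = -(a - 1) by ring, neg_div_neg_eq, show -(a - 1) = 1 - a by ring]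
  rw [e] at h
  exact h

/-- For `a > 1` and `N ≥ 1`: `Σ_{k ≥ 0} (k+N)^{−a} ≤ N^{−a} + N^{1−a}/(a−1)`. [folklore] -/
private theorem tsum_rpow_neg_tail_le' {a : ℝ} (ha : 1 < a) {N : ℕ} (hN : 1 ≤ N) :
    ∑' k : ℕ, ((k + N : ℕ) : ℝ) ^ (-a) ≤ (N : ℝ) ^ (-a) + (N : ℝ) ^ (1 - a) / (a - 1) := by
  have hs : Summable fun k : ℕ => ((k + N : ℕ) : ℝ) ^ (-a) :=
    (Real.summable_nat_rpow.2 (by linarith : -a < -1)).comp_injective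
      (add_left_injective N)
  rw [hs.tsum_eq_zero_add]
  have e : ∀ k : ℕ, ((k + 1 + N : ℕ) : ℝ) ^ (-a) = ((k + N + 1 : ℕ) : ℝ) ^ (-a) := by
    intro k; rw [Nat.add_right_comm]
  simp only [zero_add, e]
  exact add_le_add le_rfl (tsum_rpow_neg_tail_le ha hN)

/-! ## `Z22:§6.u014`: the tail `Σ_{n ≥ T³} ψ̄(n)n^{−(1−s−w)}` -/

variable {D : ℕ}

/-- **The trivial estimate for the tail** (§6 p. 32, `Z22:§6.u014`): for any `ψ (mod p) ∈ Ψ`, any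
`s, w` with `a := Re(1 − s − w) ≥ 5/4`, and `T³ ≥ 1`,
`‖Σ_{n ≥ T³} ψ̄(n)n^{−(1−s−w)}‖ ≤ 5·(T³)^{1−a}` (termwise `|ψ̄(n)| ≤ 1`, then the integral test).
[cite: Zhang2022LandauSiegel, §6 (6.2) p.32] -/
theorem norm_tailSum_le (x : Chr D) (s w : ℂ) (ha : 5 / 4 ≤ (1 - s - w).re)
    (hT : 1 ≤ bigT D ^ 3) :
    ‖tailSum x s w‖ ≤ 5 * (bigT D ^ 3) ^ (1 - (1 - s - w).re) := by
  set a : ℝ := (1 - s - w).re with ha_def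
  set N : ℕ := ⌈bigT D ^ 3⌉₊ with hN_def
  have hT0 : 0 < bigT D ^ 3 := lt_of_lt_of_le one_pos hT
  have hN1 : 1 ≤ N := Nat.one_le_ceil_iff.mpr hT0
  have hNT : bigT D ^ 3 ≤ (N : ℝ) := Nat.le_ceil _
  have hN0 : (0 : ℝ) < N := by exact_mod_cast hN1
  -- the majorant
  set g : ℕ → ℝ := fun n => if bigT D ^ 3 ≤ (n : ℝ) then (n : ℝ) ^ (-a) else 0 with hg_def
  have hg_nonneg : ∀ n, 0 ≤ g n := by
    intro n; simp only [hg_def]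
    split_ifs
    · exact Real.rpow_nonneg (Nat.cast_nonneg n) _
    · exact le_rfl
  have hmaj : Summable fun n : ℕ => (n : ℝ) ^ (-a) :=
    Real.summable_nat_rpow.2 (by linarith : -a < -1)
  have hg_le : ∀ n, g n ≤ (n : ℝ) ^ (-a) := by
    intro n; simp only [hg_def]
    split_ifs
    · exact le_rfl
    · exact Real.rpow_nonneg (Nat.cast_nonneg n) _
  have hgs : Summable g := Summable.of_nonneg_of_le hg_nonneg hg_le hmaj
  -- termwise domination
  have hterm : ∀ n : ℕ,
      ‖(if bigT D ^ 3 ≤ (n : ℝ) then psiBarFn x n * (n : ℂ) ^ (-(1 - s - w)) else 0)‖ ≤ g n := by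
    intro n
    simp only [hg_def]
    split_ifs with h
    · have hn0 : 0 < n := by
        have : (0 : ℝ) < n := lt_of_lt_of_le hT0 h
        exact_mod_cast this
      rw [norm_mul, Complex.norm_natCast_cpow_of_pos hn0]
      have h1 : ‖psiBarFn x n‖ ≤ 1 := by
        simp only [psiBarFn, Complex.norm_conj]
        exact DirichletCharacter.norm_le_one _ _
      have h2 : (-(1 - s - w)).re = -a := by simp [ha_def]
      rw [h2]
      calc ‖psiBarFn x n‖ * (n : ℝ) ^ (-a) ≤ 1 * (n : ℝ) ^ (-a) :=
            mul_le_mul_of_nonneg_right h1 (Real.rpow_nonneg (Nat.cast_nonneg n) _)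
        _ = (n : ℝ) ^ (-a) := one_mul _
    · simp
  have hbound : ‖tailSum x s w‖ ≤ ∑' n, g n := tsum_of_norm_bounded hgs.hasSum hterm
  -- the majorant sum is a tail from `N`
  have hsplit : ∑' n, g n = ∑' k : ℕ, ((k + N : ℕ) : ℝ) ^ (-a) := by
    rw [← hgs.sum_add_tsum_nat_add N]
    have hzero : ∑ i ∈ Finset.range N, g i = 0 := by
      refine Finset.sum_eq_zero fun i hi => ?_
      have hi' : (i : ℝ) < bigT D ^ 3 := Nat.lt_ceil.mp (Finset.mem_range.mp hi)
      simp only [hg_def, if_neg (not_le.mpr hi')]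
    rw [hzero, zero_add]
    refine tsum_congr fun k => ?_
    have hk : bigT D ^ 3 ≤ ((k + N : ℕ) : ℝ) := hNT.trans (by exact_mod_cast Nat.le_add_left N k)
    simp only [hg_def, if_pos hk]
  have ha1 : 1 < a := by linarith
  have htail := tsum_rpow_neg_tail_le' ha1 hN1
  -- `N^{-a} ≤ N^{1-a}`, `1/(a-1) ≤ 4`
  have hN1' : (1 : ℝ) ≤ N := by exact_mod_cast hN1
  have hpow1 : (N : ℝ) ^ (-a) ≤ (N : ℝ) ^ (1 - a) :=
    Real.rpow_le_rpow_of_exponent_le hN1' (by linarith)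
  have hpos : 0 ≤ (N : ℝ) ^ (1 - a) := Real.rpow_nonneg hN0.le _
  have hdiv : (N : ℝ) ^ (1 - a) / (a - 1) ≤ 4 * (N : ℝ) ^ (1 - a) := by
    rw [div_le_iff₀ (by linarith)]
    nlinarith
  -- `N^{1-a} ≤ (T³)^{1-a}` since `T³ ≤ N` and `1 - a ≤ 0`
  have hmono : (N : ℝ) ^ (1 - a) ≤ (bigT D ^ 3) ^ (1 - a) :=
    Real.rpow_le_rpow_of_nonpos hT0 hNT (by linarith)
  calc ‖tailSum x s w‖ ≤ ∑' n, g n := hbound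
    _ = ∑' k : ℕ, ((k + N : ℕ) : ℝ) ^ (-a) := hsplit
    _ ≤ (N : ℝ) ^ (-a) + (N : ℝ) ^ (1 - a) / (a - 1) := htail
    _ ≤ (N : ℝ) ^ (1 - a) + 4 * (N : ℝ) ^ (1 - a) := add_le_add hpow1 hdiv
    _ = 5 * (N : ℝ) ^ (1 - a) := by ring
    _ ≤ 5 * (bigT D ^ 3) ^ (1 - a) := by linarith

/-! ## Parameter bookkeeping for `D ≥ 9` -/

/-- `exp 2 ≤ 9`. [folklore] -/
private theorem exp_two_le_nine : Real.exp 2 ≤ 9 := by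
  have h1 := Real.exp_one_lt_d9
  have h2 : Real.exp 2 = Real.exp 1 * Real.exp 1 := by rw [← Real.exp_add]; norm_num
  nlinarith [Real.exp_pos 1]

/-- For `D ≥ 9`: `𝓛 = log D ≥ 2`. [cite: Zhang2022LandauSiegel, §2 (2.1)] -/
theorem two_le_ell {D : ℕ} (hD : 9 ≤ D) : 2 ≤ ell D := by
  have hD' : (9 : ℝ) ≤ D := by exact_mod_cast hD
  rw [ell, Real.le_log_iff_exp_le (by linarith)]
  exact exp_two_le_nine.trans hD'

/-- For `D ≥ 9`: `α ≤ 1/8` (indeed `α = π/𝓛⁹ ≤ π/512`). [cite: Zhang2022LandauSiegel, §2 (2.10)] -/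
theorem alpha_le {D : ℕ} (hD : 9 ≤ D) : alpha D ≤ 1 / 8 := by
  have hℓ := two_le_ell hD
  have h9 : (512 : ℝ) ≤ ell D ^ 9 := by
    calc (512 : ℝ) = 2 ^ 9 := by norm_num
      _ ≤ ell D ^ 9 := by gcongr
  rw [Section2.alpha_eq_pi_div_ell9, div_le_iff₀ (by linarith)]
  nlinarith [Real.pi_lt_four]

/-- For `D ≥ 9`: `α·𝓛^{1.1} ≤ π` (i.e. `T^{α} ≤ e^{π}`; uses `𝓛^{1.1} ≤ 𝓛⁹` for `𝓛 ≥ 1`).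
[cite: Zhang2022LandauSiegel, §6 p.30] -/
theorem alpha_mul_ell_rpow_le {D : ℕ} (hD : 9 ≤ D) : alpha D * ell D ^ (1.1 : ℝ) ≤ π := by
  have hℓ := two_le_ell hD
  have hℓ1 : (1 : ℝ) ≤ ell D := by linarith
  have h9pos : 0 < ell D ^ 9 := by positivity
  have hle : ell D ^ (1.1 : ℝ) ≤ ell D ^ 9 := by
    calc ell D ^ (1.1 : ℝ) ≤ ell D ^ ((9 : ℕ) : ℝ) :=
          Real.rpow_le_rpow_of_exponent_le hℓ1 (by norm_num)
      _ = ell D ^ 9 := Real.rpow_natCast _ _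
  rw [Section2.alpha_eq_pi_div_ell9]
  calc π / ell D ^ 9 * ell D ^ (1.1 : ℝ) ≤ π / ell D ^ 9 * ell D ^ 9 := by
        gcongr
    _ = π := by field_simp

/-- `T³ = exp(3𝓛^{1.1})`. [cite: Zhang2022LandauSiegel, §6 p.30] -/
theorem bigT_pow_three (D : ℕ) : bigT D ^ 3 = Real.exp (3 * ell D ^ (1.1 : ℝ)) := by
  rw [bigT, ← Real.exp_nat_mul]; norm_num

/-! ## `Z22:§6.u014` with the repaired exponent -/

/-- **`Z22:§6.u014`, REPAIRED** (§6 p. 32, tex L1751): for `ψ (mod p) ∈ Ψ`, `s` in the range of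
Lemma 6.1 (`|σ − 1/2| < 2α`, `|t − 2πt₀| < 𝓛₁ + 2`), `−𝓛⁹ ≤ u ≤ −1`, `|v| ≤ 𝓛²⁰`, `w = u + iv`:
`‖Σ_{n ≥ T³} ψ̄(n)n^{−(1−s−w)}‖ ≤ C·T^{3u+3/2}` with an absolute `C` (`= 5e^{6π}`), for all `D ≥ 9`.
The printed claim (`Section6Statements.Step6u014`) has the exponent `3u + 1/2`; the trivial estimate used here
gives `(T³)^{σ+u} ≤ T^{3u+3/2}·T^{6α} ≤ e^{6π}T^{3u+3/2}` (GAP-LEDGER `G-d23-1`; (6.2) survives the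
repair). [cite: Zhang2022LandauSiegel, §6 (6.2) p.32] -/
theorem stepTail_repaired : ∃ C : ℝ, ForAllLarge fun D _ χ => AssumptionA D χ → ∀ x : Chr D,
    ∀ s : ℂ, InRange61 D s → ∀ u v : ℝ, -(ell D ^ 9) ≤ u → u ≤ -1 → |v| ≤ ell D ^ 20 →
      ‖tailSum x s (u + v * I)‖ ≤ C * bigT D ^ (3 * u + 3 / 2) := by
  refine ⟨5 * Real.exp (6 * π), 9, fun D _ χ hD _ _ _ x s hs u v _ hu1 _ => ?_⟩
  have hα := alpha_le hD
  have hαL := alpha_mul_ell_rpow_le hD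
  have hα0 : 0 ≤ alpha D := by
    rw [Section2.alpha_eq_pi_div_ell9]; exact div_nonneg Real.pi_pos.le (pow_nonneg (Real.log_natCast_nonneg D) _)
  obtain ⟨hσ, _⟩ := hs
  have hσ2 := (abs_lt.mp hσ).2
  set L : ℝ := ell D ^ (1.1 : ℝ) with hL
  have hL0 : 0 ≤ L := Real.rpow_nonneg (Real.log_natCast_nonneg D) _
  -- the real part of the exponent
  have hre : (1 - s - ((u : ℂ) + (v : ℂ) * I)).re = 1 - s.re - u := by simp
  have ha : 5 / 4 ≤ (1 - s - ((u : ℂ) + (v : ℂ) * I)).re := by rw [hre]; linarith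
  have hT1 : 1 ≤ bigT D ^ 3 :=
    one_le_pow₀ (Real.one_le_exp (Real.rpow_nonneg (Real.log_natCast_nonneg D) _))
  have h := norm_tailSum_le x s ((u : ℂ) + (v : ℂ) * I) ha hT1
  rw [hre, bigT_pow_three, ← Real.exp_mul] at h
  -- compare exponents: `3L(σ+u) ≤ 6π + L(3u + 3/2)`
  have hexp : 3 * ell D ^ (1.1 : ℝ) * (1 - (1 - s.re - u)) ≤ 6 * π + L * (3 * u + 3 / 2) := by
    have h1 : 3 * L * s.re ≤ 3 * L * (1 / 2 + 2 * alpha D) :=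
      mul_le_mul_of_nonneg_left (by linarith) (by positivity)
    have h2 : alpha D * L ≤ π := hαL
    rw [← hL]
    nlinarith
  have hmain : Real.exp (3 * ell D ^ (1.1 : ℝ) * (1 - (1 - s.re - u))) ≤
      Real.exp (6 * π) * bigT D ^ (3 * u + 3 / 2) := by
    rw [bigT, ← hL, ← Real.exp_mul, ← Real.exp_add]
    exact Real.exp_le_exp.mpr hexp
  calc ‖tailSum x s ((u : ℂ) + (v : ℂ) * I)‖
      ≤ 5 * Real.exp (3 * ell D ^ (1.1 : ℝ) * (1 - (1 - s.re - u))) := h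
    _ ≤ 5 * (Real.exp (6 * π) * bigT D ^ (3 * u + 3 / 2)) := by linarith
    _ = 5 * Real.exp (6 * π) * bigT D ^ (3 * u + 3 / 2) := by ring

end Literature.NumberTheory.LFunctions.Zhang2022.Section6TailBounds
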